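import Summits.QuantumFields.YangMills.Theorems.NPointIsotropy.Negative.TieLoadBearing
import Summits.QuantumFields.YangMills.Theorems.PencilRigidityNPointIsotropyOffDiagCutoff
import Summits.QuantumFields.YangMills.Theorems.PencilRigidityNPointIsotropyOffDiagCutoffTendsto
import Summits.QuantumFields.YangMills.Theorems.PencilRigidityNPointIsotropyLocalOffDiagDensity
import Summits.QuantumFields.YangMills.Theorems.PencilRigidityNPointIsotropyOffDiagDensity
import Summits.QuantumFields.YangMills.Theorems.PencilRigidityNPointIsotropyBetaZeroSlice
import HarnessLib

/-!
# `⁰𝒮` is the closed span of the off-diagonal real product tensors — unconditionally; consequences for the crux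

Support file for crux `stmt-QuantumFields-11686` (`PencilRigidity.NPointIsotropy`), line
`complex-rotation-bandlimit`, generation 5, wave 2 (lead `prover-line-stmt-QuantumFields-11686-c1-0`). It composes the
five landed helper stubs of the wave —

* `offDiagCutoffFamily` (`…OffDiagCutoff`): smooth diagonal cut-offs `ψ_k` on `(ℝ⁴)ⁿ`, `= 1` where all pairwise
  distances are `≥ 2/(k+1)`, `= 0` where some pairwise distance is `≤ 1/(k+1)`, `‖Dˡψ_k‖ ≤ C_l (k+1)ˡ`;
* `offDiagCutoffTendsto` (`…OffDiagCutoffTendsto`): for `F ∈ ⁰𝒮` (flat on the coincidence locus), `ψ_k F → F` in the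
  Schwartz topology (flatness beats `(k+1)ˡ`);
* `localOffDiagDensity` (`…LocalOffDiagDensity`): a test function with COMPACT support off the diagonals lies in the
  closed `ℂ`-span of the off-diagonal real product tensors (lattice partition of unity + the tree's box engine
  `mem_closure_span_boxTensors` with pairwise disjoint blocks);
* `offDiagDensity` (`…OffDiagDensity`): assembly of the three into the density statement (implication form);
* `betaZeroPlanarInvariant` (`…BetaZeroSlice`): density ⇒ the crux's conclusion on the `β_k = 0`-frequently slice;

into UNCONDITIONAL statements:

* `isOffDiagonal_mem_closure_span_tensors` — **`⁰𝒮((ℝ⁴)ⁿ)` is the closure, for the Schwartz topology, of the `ℂ`-span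
  of the off-diagonal real product tensors `f₁ ⊗ ⋯ ⊗ fₙ` (`IsTensorOf P (ofRealTest ∘ f)`, `IsOffDiagonal P`)** — the
  `⁰𝒮` analogue of Osterwalder–Schrader's `𝒮(ℝ^{4n}) = ⊗̂ⁿ 𝒮(ℝ⁴)` (1973, §2) and of the tree's positive- and ordered-wedge
  densities;
* `eq_zero_offDiagonal_of_forall_tensor`, `eqOn_offDiagonal_of_eqOn_tensors'`: a continuous linear functional (resp.
  two of them) is determined on `⁰𝒮` by its values on off-diagonal real product tensors;
* `tie_pins_offDiagonal`: **the lattice tie PINS a family on `⁰𝒮`** — two families tied to the curvature channel of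
  the same Wilson scheme agree on every off-diagonal test function of positive degree (so the crux is a statement about
  Wilson scaling limits and nothing else: its truth value is that of "every tied limit is planar-rotation invariant on
  tensors");
* `planarInvariant_of_tensors'`: `PlanarInvariant S₁` follows from invariance on off-diagonal real tensors of positive
  degree under every linear isometry;
* `planarInvariant_of_tie_of_beta_zero`, `nPointIsotropy_betaZeroSlice`: **the `β_k = 0`-frequently slice of the crux
  is PROVED outright** — every family tied to such a scheme (any compact `G`, any faithful `r`, any `c_k, m_k, a_k,
  L_k`) satisfies `PlanarInvariant`, with or without the OS package, the eight frames or the radial kernel;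
* `nPointIsotropy_iff_latticeTensorForm`: **what is left of the crux, in lattice terms** — `NPointIsotropy` holds iff along
  every scheme of the crux the Wilson lattice `n`-point functions (`n ≥ 3`) have the same limit on rotated and unrotated
  off-diagonal real product tensors;
* `planarInvariantOfTensors3` (registered sub-goal), `nPointIsotropy_of_tensors3`: **the crux REDUCES, family by
  family, to off-diagonal real product tensors of degree `≥ 3`**: a tied family with the radial kernel that is invariant
  under the planar rotations on off-diagonal real tensors `f₁ ⊗ ⋯ ⊗ fₙ`, `n ≥ 3`, satisfies `PlanarInvariant`
  (degrees `≤ 2` by `cruxDegreesLeTwo`, density for the rest); hence `NPointIsotropy` follows from its tensor form.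
[folklore]
-/

noncomputable section

namespace Summit.QuantumFields.YangMills.Theorems.NPointIsotropy.ComplexRotationBandlimit

open scoped SchwartzMap
open MeasureTheory Filter Topology
open Literature.MathematicalPhysics.QuantumLattice Literature.MathematicalPhysics.AQFT
  Literature.MathematicalPhysics.QuantumFieldTheory
open Summit.QuantumFields.YangMills.Theorems.NPointIsotropy.Negative (E4 RadialKernel nPointIsotropy_iff)
open Summit.QuantumFields.YangMills.Theorems.CurvatureBoostCovariance.Negative
  (Tie W1 EightFrameRP PlanarInvariant isOffDiagonal_linActMulti)

/-- **`⁰𝒮` is the closed span of the off-diagonal real product tensors** (unconditional): every Schwartz test function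
on `(ℝ⁴)ⁿ` that vanishes with all derivatives on the coincidence locus lies in the closure, for the Schwartz topology,
of the `ℂ`-span of the real product tensors `f₁ ⊗ ⋯ ⊗ fₙ` that are themselves off-diagonal. [folklore] -/
theorem isOffDiagonal_mem_closure_span_tensors (n : ℕ) (F : 𝓢((Fin n → E4), ℂ)) (hF : IsOffDiagonal F) :
    F ∈ closure (Submodule.span ℂ {P : 𝓢((Fin n → E4), ℂ) | ∃ f : Fin n → 𝓢(E4, ℝ),
      IsTensorOf P (fun i => ofRealTest (f i)) ∧ IsOffDiagonal P} : Set (𝓢((Fin n → E4), ℂ))) :=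
  offDiagDensity offDiagCutoffFamily offDiagCutoffTendsto localOffDiagDensity n F hF

/-- **A continuous linear functional vanishing on the off-diagonal real product tensors vanishes on `⁰𝒮`.** [folklore] -/
theorem eq_zero_offDiagonal_of_forall_tensor {n : ℕ} (T : 𝓢((Fin n → E4), ℂ) →L[ℂ] ℂ)
    (hT : ∀ (f : Fin n → 𝓢(E4, ℝ)) (P : 𝓢((Fin n → E4), ℂ)),
      IsTensorOf P (fun i => ofRealTest (f i)) → IsOffDiagonal P → T P = 0)
    (F : 𝓢((Fin n → E4), ℂ)) (hF : IsOffDiagonal F) : T F = 0 :=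
  offDiagDensity_functional_of_density isOffDiagonal_mem_closure_span_tensors n T hT F hF

/-- **Two continuous linear functionals that agree on the off-diagonal real product tensors agree on `⁰𝒮`.** [folklore] -/
theorem eqOn_offDiagonal_of_eqOn_tensors' {n : ℕ} (A B : 𝓢((Fin n → E4), ℂ) →L[ℂ] ℂ)
    (hAB : ∀ (f : Fin n → 𝓢(E4, ℝ)) (P : 𝓢((Fin n → E4), ℂ)),
      IsTensorOf P (fun i => ofRealTest (f i)) → IsOffDiagonal P → A P = B P)
    (F : 𝓢((Fin n → E4), ℂ)) (hF : IsOffDiagonal F) : A F = B F :=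
  eqOn_offDiagonal_of_eqOn_tensors isOffDiagonal_mem_closure_span_tensors A B hAB F hF

/-- **`PlanarInvariant` from invariance on tensors** (unconditional form of `planarInvariant_of_tensors`): a
one-species Schwinger family on `ℝ⁴` invariant on off-diagonal real product tensors of positive degree under every
linear isometry is invariant on all of `⁰𝒮` under the rotations of the `(x₀,x₁)`-plane. [folklore] -/
theorem planarInvariant_of_tensors' (S₁ : SchwingerFamily E4)
    (h : ∀ (R : E4 ≃ₗᵢ[ℝ] E4) (n : ℕ), n ≠ 0 → ∀ (f : Fin n → 𝓢(E4, ℝ)) (F : 𝓢((Fin n → E4), ℂ)),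
      IsTensorOf F (fun i => ofRealTest (f i)) → IsOffDiagonal F → S₁ n (linActMulti R F) = S₁ n F) :
    PlanarInvariant S₁ :=
  planarInvariant_of_tensors isOffDiagonal_mem_closure_span_tensors S₁ h

section Tied

variable {G : Type} [Group G] [TopologicalSpace G] [IsTopologicalGroup G] [CompactSpace G]
  [MeasurableSpace G] [BorelSpace G]

/-- **The lattice tie PINS a family on `⁰𝒮`**: two one-species families tied to the curvature channel of Wilson's
lattice theory along the SAME scheme `(r, sch)` agree on every off-diagonal test function of positive degree (they
agree on off-diagonal real tensors by uniqueness of limits, `tie_unique`, and `⁰𝒮` is their closed span). So every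
value the crux's conclusion inspects (degrees `≥ 1`) is a function of the bare lattice data alone. [folklore] -/
theorem tie_pins_offDiagonal {r : LatticeRep G} {sch : SpeciesScheme (YMSpecies G)} {S₁ S₁' : SchwingerFamily E4}
    (h₁ : Tie r sch S₁) (h₁' : Tie r sch S₁') {n : ℕ} (hn : n ≠ 0) (F : 𝓢((Fin n → E4), ℂ))
    (hF : IsOffDiagonal F) : S₁ n F = S₁' n F :=
  tie_unique_offDiagonal isOffDiagonal_mem_closure_span_tensors h₁ h₁' hn F hF

/-- **The `β_k = 0`-frequently slice, outright**: every family tied to a scheme with `β_k = 0` for infinitely many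
`k` satisfies `PlanarInvariant` (indeed invariance under every linear isometry on `⁰𝒮` in positive degree) — no OS
clause, frame or kernel hypothesis is needed. [folklore] -/
theorem planarInvariant_of_tie_of_beta_zero (r : LatticeRep G) (sch : SpeciesScheme (YMSpecies G))
    (S₁ : SchwingerFamily E4) (htie : Tie r sch S₁) (hβ : ∃ᶠ k in atTop, sch.β k = 0) : PlanarInvariant S₁ :=
  betaZeroPlanarInvariant isOffDiagonal_mem_closure_span_tensors G r sch S₁ htie hβ

end Tied

/-- **The crux restricted to the `β_k = 0`-frequently slice of scheme space is PROVED**: for every compact simple `G`,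
every `r`, every scheme with `β_k = 0` for infinitely many `k` and every `S₁` carrying `W₁`, the eight frames and the
radial kernel (only the tie inside `W₁` is used), `PlanarInvariant S₁`. Together with the opening disprover's
`c ≡ 0` collapse this exhausts the schemes whose tie the tree can compute. [folklore] -/
theorem nPointIsotropy_betaZeroSlice :
    ∀ (G : Type) [Group G] [TopologicalSpace G] [IsTopologicalGroup G] [CompactSpace G],
      IsCompactSimpleLieGroup G →
      letI : MeasurableSpace G := borel G
      haveI : BorelSpace G := ⟨rfl⟩
      ∀ (r : LatticeRep G) (sch : SpeciesScheme (YMSpecies G)) (S₁ : SchwingerFamily E4),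
        W1 r sch S₁ → (∃ᶠ k in atTop, sch.β k = 0) → EightFrameRP S₁ → RadialKernel S₁ → PlanarInvariant S₁ := by
  intro G _ _ _ _ _
  letI : MeasurableSpace G := borel G
  haveI : BorelSpace G := ⟨rfl⟩
  intro r sch S₁ hW hβ _ _
  exact planarInvariant_of_tie_of_beta_zero r sch S₁ hW.1 hβ

/-- **The crux reduces, family by family, to off-diagonal real product tensors of degree `≥ 3`** (registered
sub-goal `planarInvariantOfTensors3` of stmt-QuantumFields-11686): a family tied to the curvature channel of Wilson's
lattice theory along a scheme, with the radial two-point kernel, that is invariant under the planar rotations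
(determinant one, fixing `e₂, e₃`) on the off-diagonal real product tensors `f₁ ⊗ ⋯ ⊗ fₙ` of every degree `n ≥ 3`
satisfies `PlanarInvariant` — degrees `≤ 2` are `cruxDegreesLeTwo` (tie + radial kernel, every isometry, all of `⁰𝒮`),
and in degrees `≥ 3` the continuous functionals `S₁ n ∘ (R · )` and `S₁ n` agree on `⁰𝒮` because they agree on its
generating tensors (`eqOn_offDiagonal_of_eqOn_tensors'`). On tensors the tie pins `S₁ n` as the limit of the lattice
`n`-point functions (`tie_pins_offDiagonal`), so what is left of the crux for each `(G, r, sch)` is a statement about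
Wilson's lattice expectations along the scheme in degrees `≥ 3`. [folklore] -/
theorem planarInvariantOfTensors3 :
    ∀ (G : Type) [Group G] [TopologicalSpace G] [IsTopologicalGroup G] [CompactSpace G] [MeasurableSpace G] [BorelSpace G] (r : Literature.MathematicalPhysics.QuantumFieldTheory.LatticeRep G) (sch : Literature.MathematicalPhysics.QuantumFieldTheory.SpeciesScheme (Literature.MathematicalPhysics.QuantumFieldTheory.YMSpecies G)) (S₁ : Literature.MathematicalPhysics.QuantumLattice.SchwingerFamily (EuclideanSpace ℝ (Fin 4))), Summit.QuantumFields.YangMills.Theorems.CurvatureBoostCovariance.Negative.Tie r sch S₁ → Summit.QuantumFields.YangMills.Theorems.NPointIsotropy.Negative.RadialKernel S₁ → (∀ (R : EuclideanSpace ℝ (Fin 4) ≃ₗᵢ[ℝ] EuclideanSpace ℝ (Fin 4)), LinearMap.det (R.toLinearEquiv : EuclideanSpace ℝ (Fin 4) →ₗ[ℝ] EuclideanSpace ℝ (Fin 4)) = 1 → R (EuclideanSpace.single 2 1) = EuclideanSpace.single 2 1 → R (EuclideanSpace.single 3 1) = EuclideanSpace.single 3 1 → ∀ (n : ℕ), 3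 ≤ n → ∀ (f : Fin n → SchwartzMap (EuclideanSpace ℝ (Fin 4)) ℝ) (F : SchwartzMap (Fin n → EuclideanSpace ℝ (Fin 4)) ℂ), Literature.MathematicalPhysics.QuantumLattice.IsTensorOf F (fun i => Literature.MathematicalPhysics.QuantumLattice.ofRealTest (f i)) → Literature.MathematicalPhysics.AQFT.IsOffDiagonal F → S₁ n (Literature.MathematicalPhysics.QuantumLattice.linActMulti R F) = S₁ n F) → Summit.QuantumFields.YangMills.Theorems.CurvatureBoostCovariance.Negative.PlanarInvariant S₁ := by
  intro G _ _ _ _ _ _ r sch S₁ htie hK h R hdet h2 h3 n F hF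
  rcases Nat.lt_or_ge n 3 with hn | hn
  · exact cruxDegreesLeTwo G r sch S₁ htie hK R n (by omega) F hF
  · refine eqOn_offDiagonal_of_eqOn_tensors' ((S₁ n).comp (linActMulti R)) (S₁ n) (fun f P hP hP' => ?_) F hF
    exact h R hdet h2 h3 n hn f P hP hP'

/-- **Hence the crux itself reduces to tensors of degree `≥ 3`**: `NPointIsotropy` follows from its restriction to
off-diagonal real product tensors of degree `≥ 3` (conclusion weakened, hypotheses unchanged). [folklore] -/
theorem nPointIsotropy_of_tensors3
    (h : ∀ (G : Type) [Group G] [TopologicalSpace G] [IsTopologicalGroup G] [CompactSpace G],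
      IsCompactSimpleLieGroup G →
      letI : MeasurableSpace G := borel G
      haveI : BorelSpace G := ⟨rfl⟩
      ∀ (r : LatticeRep G) (sch : SpeciesScheme (YMSpecies G)) (S₁ : SchwingerFamily E4),
        W1 r sch S₁ → EightFrameRP S₁ → RadialKernel S₁ →
        ∀ (R : E4 ≃ₗᵢ[ℝ] E4), LinearMap.det (R.toLinearEquiv : E4 →ₗ[ℝ] E4) = 1 →
          R (EuclideanSpace.single 2 1) = EuclideanSpace.single 2 1 →
          R (EuclideanSpace.single 3 1) = EuclideanSpace.single 3 1 →
          ∀ (n : ℕ), 3 ≤ n → ∀ (f : Fin n → 𝓢(E4, ℝ)) (F : 𝓢((Fin n → E4), ℂ)),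
            IsTensorOf F (fun i => ofRealTest (f i)) → IsOffDiagonal F → S₁ n (linActMulti R F) = S₁ n F) :
    Summit.QuantumFields.YangMills.Theses.PencilRigidity.NPointIsotropy := by
  rw [nPointIsotropy_iff]
  intro G _ _ _ _ hG
  letI : MeasurableSpace G := borel G
  haveI : BorelSpace G := ⟨rfl⟩
  intro r sch S₁ hW h8 hK
  exact planarInvariantOfTensors3 G r sch S₁ hW.1 hK (h G hG r sch S₁ hW h8 hK)

/-- **What is left of the crux, in lattice terms** (`NPointIsotropy` ⇔ its LATTICE TENSOR FORM): the crux holds iff,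
for every family of the crux, every planar rotation `R`, every degree `n ≥ 3` and every off-diagonal real product
tensor `f₁ ⊗ ⋯ ⊗ fₙ`, the lattice `n`-point functions of Wilson's theory along the scheme, evaluated on the rotated and on
the unrotated test functions, have the SAME limit: `latticeSchwinger(k, n, (fᵢ ∘ R⁻¹)ᵢ) − latticeSchwinger(k, n, f) → 0`.
(`→`: both sequences converge by the tie, to `S₁ n (R · F)` and `S₁ n F`, which the crux equates; `←`: the tie turns the
lattice statement into equality on tensors, and `nPointIsotropy_of_tensors3` lifts it to `⁰𝒮`.) So, given the
hypotheses `W₁`, the eight frames and the radial kernel (which only say that the limit exists and is an OS family of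
the stated kind), the content of the crux is a universality statement about Wilson lattice expectations of the
renormalised action density along the scheme, in degrees `≥ 3`. [folklore] -/
theorem nPointIsotropy_iff_latticeTensorForm :
    Summit.QuantumFields.YangMills.Theses.PencilRigidity.NPointIsotropy ↔
      ∀ (G : Type) [Group G] [TopologicalSpace G] [IsTopologicalGroup G] [CompactSpace G],
        IsCompactSimpleLieGroup G →
        letI : MeasurableSpace G := borel G
        haveI : BorelSpace G := ⟨rfl⟩
        ∀ (r : LatticeRep G) (sch : SpeciesScheme (YMSpecies G)) (S₁ : SchwingerFamily E4),
          W1 r sch S₁ → EightFrameRP S₁ → RadialKernel S₁ →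
          ∀ (R : E4 ≃ₗᵢ[ℝ] E4), LinearMap.det (R.toLinearEquiv : E4 →ₗ[ℝ] E4) = 1 →
            R (EuclideanSpace.single 2 1) = EuclideanSpace.single 2 1 →
            R (EuclideanSpace.single 3 1) = EuclideanSpace.single 3 1 →
            ∀ (n : ℕ), 3 ≤ n → ∀ (f : Fin n → 𝓢(E4, ℝ)) (F : 𝓢((Fin n → E4), ℂ)),
              IsTensorOf F (fun i => ofRealTest (f i)) → IsOffDiagonal F →
                Tendsto (fun k : ℕ =>
                  latticeSchwinger r.ρ sch (fun s => s.F) k n (fun _ => r.curvature) (fun i => linActTest R (f i)) -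
                    latticeSchwinger r.ρ sch (fun s => s.F) k n (fun _ => r.curvature) f) atTop (𝓝 0) := by
  rw [nPointIsotropy_iff]
  constructor
  · intro h G _ _ _ _ hG
    letI : MeasurableSpace G := borel G
    haveI : BorelSpace G := ⟨rfl⟩
    intro r sch S₁ hW h8 hK R hdet h2 h3 n hn f F hF hF'
    have hn0 : n ≠ 0 := by omega
    have hRF := hW.1 n hn0 (fun i => linActTest R (f i)) (linActMulti R F) (hF.linActMulti R)
      (isOffDiagonal_linActMulti hF' R)
    have hFF := hW.1 n hn0 f F hF hF'
    have heq : S₁ n (linActMulti R F) = S₁ n F := h G hG r sch S₁ hW h8 hK R hdet h2 h3 n F hF'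
    rw [heq] at hRF
    have hsub := hRF.sub hFF
    rw [sub_self] at hsub
    have hre := (Complex.continuous_re.tendsto 0).comp hsub
    refine hre.congr fun k => ?_
    simp only [Function.comp_apply, Complex.sub_re, Complex.ofReal_re]
  · intro h G _ _ _ _ hG
    letI : MeasurableSpace G := borel G
    haveI : BorelSpace G := ⟨rfl⟩
    intro r sch S₁ hW h8 hK
    refine planarInvariantOfTensors3 G r sch S₁ hW.1 hK fun R hdet h2 h3 n hn f F hF hF' => ?_
    have hn0 : n ≠ 0 := by omega
    have hRF := hW.1 n hn0 (fun i => linActTest R (f i)) (linActMulti R F) (hF.linActMulti R)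
      (isOffDiagonal_linActMulti hF' R)
    have hFF := hW.1 n hn0 f F hF hF'
    have hlat := h G hG r sch S₁ hW h8 hK R hdet h2 h3 n hn f F hF hF'
    have hsub := hRF.sub hFF
    have hlatC : Tendsto (fun k : ℕ =>
        ((latticeSchwinger r.ρ sch (fun s => s.F) k n (fun _ => r.curvature) (fun i => linActTest R (f i)) : ℝ) : ℂ) -
          ((latticeSchwinger r.ρ sch (fun s => s.F) k n (fun _ => r.curvature) f : ℝ) : ℂ)) atTop (𝓝 0) := by
      have := (Complex.continuous_ofReal.tendsto 0).comp hlat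
      simpa [Function.comp_def, Complex.ofReal_sub] using this
    exact sub_eq_zero.1 (tendsto_nhds_unique hsub hlatC)

end Summit.QuantumFields.YangMills.Theorems.NPointIsotropy.ComplexRotationBandlimit

end
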